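import Summits.NavierStokesRegularity.NavierStokesRegularity.Theorems.TerminalTraceTypeITraceScarL3ApexZoomLimit
import Summits.NavierStokesRegularity.NavierStokesRegularity.Theorems.TerminalTraceTypeITraceScarL3ApexPackageTranslate
import Summits.NavierStokesRegularity.NavierStokesRegularity.Theorems.TerminalTraceTypeITraceScarL3LoudDustUniformlyPerfect
import HarnessLib

/-!
# CASE-2 ZOOM PACKAGE (stub Z5 `stub_caseTwoZoom` of the line `radius_dichotomy`, item `TerminalTrace.TypeITraceScarL3`,
# stmt-NavierStokesRegularity-18385): the zoom at the top singular point NEAREST to a regular top point is an extinct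
# Type-I apex that is a.e. bounded on a late HALF-SPACE slab and non-trivial

Seat nsreg-C26-p1 g5 (cell ns-regularity-ideate), `--supports stmt-NavierStokesRegularity-18385`; memo
`HOME/nsreg-C26-p1-LOUD-ZOOM-18385.md` §3, skeleton `Cruxes/TypeITraceScarL3/Lines/radius_dichotomy_CANDIDATE.lean` (v5.1).

Proof. Let `Σ₀` be the (closed, `isClosed_topSingularSet`) set of backward-singular top points, `y₁` a regular top point,
`d = dist(y₁, Σ₀) > 0`, `x* ∈ Σ₀` with `dist y₁ x* = d` (`IsClosed.exists_infDist_eq_dist`), `e = (y₁ − x*)/d`. The space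
translate to `x*` carries the package (`apexPackage_translate`) with a singular origin; its zoom limit at the origin is an
extinct Type-I apex of some class, non-trivial on `Q(1)`, with the zooms converging in `L³(Q(a))`
(`exists_apexZoomLimit`). THE GEOMETRY (memo §3(a)): for `⟨y, e⟩ > 1`, `|y| < R` and a scale `0 < λ ≤ min(1, d/R²)`
the point `x* + λ y` lies within `d − λ/2` of `y₁`, hence at distance `≥ λ/2` from `Σ₀`; CASE 2 (constant `c₀`, wlog
`c₀ ≤ 1`) makes the radius `c₀ λ/2` admissible there, i.e. the `λ`-zoom is a.e. bounded by `2/c₀` on `Q_{c₀/2}(0, y)`.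
A countable dense set of centres covers `]−(c₀/2)², 0[ × ({⟨y, e⟩ > 1} ∩ B(0, R))`, the bound passes to the `L³` limit
(`ae_le_of_tendsto_eLpNorm_three`), and `R → ∞`.
WHAT THIS IS NOT: 18385 / NS regularity NOT proved; Z2/Z4 remain. [folklore; EscauriazaSereginSverak2003 §3; Seregin2014 §6.6]
-/

noncomputable section

set_option linter.dupNamespace false

namespace Summit.NavierStokesRegularity.NavierStokesRegularity.Theorems.TypeITraceScarL3

open MeasureTheory Set Function Filter Topology TopologicalSpace Metric InnerProductSpace
open Literature.Analysis.FluidPDE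
open scoped NNReal ENNReal RealInnerProductSpace

/-- The space translation `(s, y) ↦ (s, y + v)` pulls `Q_r(0, c)` back to `Q_r(0, c − v)`. [folklore] -/
theorem preimage_translate_parabolicCylinder_top (v c : EuclideanSpace ℝ (Fin 3)) (r : ℝ) :
    (fun z : ℝ × EuclideanSpace ℝ (Fin 3) => (z.1, z.2 + v)) ⁻¹'
        parabolicCylinder r (((0 : ℝ), c) : ℝ × EuclideanSpace ℝ (Fin 3)) =
      parabolicCylinder r (((0 : ℝ), c - v) : ℝ × EuclideanSpace ℝ (Fin 3)) := by
  ext ⟨s, y⟩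
  simp only [mem_preimage, mem_parabolicCylinder]
  rw [dist_eq_norm, dist_eq_norm, show y + v - c = y - (c - v) by abel]

/-- **The nearest-point geometry** (memo §3(a)): if `B(y₁, d) ∩ Σ = ∅` (every point of `Σ` is at distance `≥ d` from
`y₁`), `x* ∈ Σ` with `dist y₁ x* = d > 0`, `e = d⁻¹ • (y₁ − x*)`, then for `⟨y, e⟩ > 1`, `‖y‖ < R` (`R ≥ 1`) and
`0 < λ ≤ d/R²` every point of `Σ` is at distance `≥ λ/2` from `x* + λ • y`. [folklore] -/
theorem halfSpace_point_far_from_singular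
    {S : Set (EuclideanSpace ℝ (Fin 3))} {y₁ xs : EuclideanSpace ℝ (Fin 3)} {d : ℝ} (hd : 0 < d)
    (hfar : ∀ σ ∈ S, d ≤ dist y₁ σ) (hxs : dist y₁ xs = d)
    {y : EuclideanSpace ℝ (Fin 3)} {R lam : ℝ} (hR : 1 ≤ R) (hy : 1 < ⟪y, d⁻¹ • (y₁ - xs)⟫) (hyR : ‖y‖ < R)
    (hlam : 0 < lam) (hlamR : lam ≤ d / R ^ 2) :
    ∀ σ ∈ S, lam / 2 ≤ dist (xs + lam • y) σ := by
  intro σ hσ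
  -- `‖(x* + λ y) − y₁‖ ≤ d − λ/2`
  have hnorm : ‖y₁ - xs‖ = d := by rw [← dist_eq_norm]; exact hxs
  have hinner : ⟪y, y₁ - xs⟫ = d * ⟪y, d⁻¹ • (y₁ - xs)⟫ := by
    rw [real_inner_smul_right]; field_simp
  have ht : d < ⟪y, y₁ - xs⟫ := by
    rw [hinner]; nlinarith
  have hsq : ‖lam • y - (y₁ - xs)‖ ^ 2 = lam ^ 2 * ‖y‖ ^ 2 - 2 * lam * ⟪y, y₁ - xs⟫ + d ^ 2 := by
    rw [@norm_sub_sq_real, norm_smul, Real.norm_of_nonneg hlam.le, real_inner_smul_left, hnorm]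
    ring
  have hy2 : ‖y‖ ^ 2 ≤ R ^ 2 := by
    have := pow_le_pow_left₀ (norm_nonneg y) hyR.le 2
    exact this
  have hlamR' : lam * R ^ 2 ≤ d := by
    have hR2 : 0 < R ^ 2 := by positivity
    rwa [le_div_iff₀ hR2] at hlamR
  have hle : ‖lam • y - (y₁ - xs)‖ ^ 2 ≤ (d - lam / 2) ^ 2 := by
    rw [hsq]
    nlinarith [mul_le_mul_of_nonneg_left hy2 (pow_pos hlam 2).le, hlam, ht, hd]
  have hdl : 0 ≤ d - lam / 2 := by
    have : lam ≤ d := by nlinarith [hR]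
    linarith
  have hdist : dist (xs + lam • y) y₁ ≤ d - lam / 2 := by
    rw [dist_eq_norm, show xs + lam • y - y₁ = lam • y - (y₁ - xs) by abel]
    exact (pow_le_pow_iff_left₀ (norm_nonneg _) hdl two_ne_zero).1 hle
  -- triangle inequality
  have := hfar σ hσ
  have htri : dist y₁ σ ≤ dist y₁ (xs + lam • y) + dist (xs + lam • y) σ := dist_triangle _ _ _
  rw [dist_comm y₁ (xs + lam • y)] at htri
  linarith

set_option maxHeartbeats 3200000 in
/-- **Stub Z5 «CASE-2 ZOOM PACKAGE»** (`stub_caseTwoZoom` of `Lines/radius_dichotomy_CANDIDATE.lean` v5.1, statement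
VERBATIM): see the module docstring. [cite: EscauriazaSereginSverak2003, §3; Seregin2014, §6.6 Prop. 6.20] -/
theorem caseTwoZoom :
    ∀ (U : ℝ → EuclideanSpace ℝ (Fin 3) → EuclideanSpace ℝ (Fin 3))
      (P : ℝ → EuclideanSpace ℝ (Fin 3) → ℝ)
      (G : ℝ → EuclideanSpace ℝ (Fin 3) →
        EuclideanSpace ℝ (Fin 3) →L[ℝ] EuclideanSpace ℝ (Fin 3))
      (M D₀ : ℝ≥0) (C : ℝ),
      (∀ a : ℝ, 0 < a →
        IsSuitableWeakSolutionInBall a (0 : ℝ × EuclideanSpace ℝ (Fin 3)) U P) →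
      (∀ a : ℝ, 0 < a →
        HasWeakSpatialGradientOn
          (parabolicCylinderOpens a (0 : ℝ × EuclideanSpace ℝ (Fin 3))) U G) →
      (∀ a : ℝ, 0 < a →
        typeIBound (parabolicCylinder a (0 : ℝ × EuclideanSpace ℝ (Fin 3))) U P G ≤ M) →
      (∀ z₀ : ℝ × EuclideanSpace ℝ (Fin 3), z₀.1 ≤ 0 →
        ∀ r : ℝ, 0 < r → cknD r z₀ P ≤ D₀) →
      (∀ s : ℝ, s < 0 →
        ∀ᵐ y : EuclideanSpace ℝ (Fin 3), ‖U s y‖ ≤ C / Real.sqrt (-s)) →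
      (∀ φ : EuclideanSpace ℝ (Fin 3) → EuclideanSpace ℝ (Fin 3),
        ContDiff ℝ (⊤ : ℕ∞) φ →
        HasCompactSupport φ → ∀ ε : ℝ, 0 < ε →
        ∃ s₀ : ℝ, s₀ < 0 ∧ ∀ᵐ s ∂(volume.restrict (Ioo s₀ 0)), |∫ y, ⟪U s y, φ y⟫| ≤ ε) →
      IsBackwardSingularPoint U (0 : ℝ × EuclideanSpace ℝ (Fin 3)) →
      (∃ y₁ : EuclideanSpace ℝ (Fin 3), ¬ IsBackwardSingularPoint U ((0 : ℝ), y₁)) →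
      (∃ c₀ : ℝ, 0 < c₀ ∧ ∀ y : EuclideanSpace ℝ (Fin 3),
        ¬ IsBackwardSingularPoint U ((0 : ℝ), y) →
        ∀ r : ℝ, 0 < r →
          r ≤ c₀ * min (infDist y {x : EuclideanSpace ℝ (Fin 3) | IsBackwardSingularPoint U ((0 : ℝ), x)}) 1 →
          ∀ᵐ z ∂(volume.restrict (parabolicCylinder r (((0 : ℝ), y) : ℝ × EuclideanSpace ℝ (Fin 3)))),
            ‖U z.1 z.2‖ ≤ r⁻¹) →
      ∃ (M' D₀' : ℝ≥0) (C' : ℝ) (V : ℝ → EuclideanSpace ℝ (Fin 3) → EuclideanSpace ℝ (Fin 3))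
        (Q : ℝ → EuclideanSpace ℝ (Fin 3) → ℝ)
        (H : ℝ → EuclideanSpace ℝ (Fin 3) →
          EuclideanSpace ℝ (Fin 3) →L[ℝ] EuclideanSpace ℝ (Fin 3)),
      (∀ a : ℝ, 0 < a →
        IsSuitableWeakSolutionInBall a (0 : ℝ × EuclideanSpace ℝ (Fin 3)) V Q) ∧
      (∀ a : ℝ, 0 < a →
        HasWeakSpatialGradientOn
          (parabolicCylinderOpens a (0 : ℝ × EuclideanSpace ℝ (Fin 3))) V H) ∧
      (∀ a : ℝ, 0 < a →
        typeIBound (parabolicCylinder a (0 : ℝ × EuclideanSpace ℝ (Fin 3))) V Q H ≤ M') ∧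
      (∀ z₀ : ℝ × EuclideanSpace ℝ (Fin 3), z₀.1 ≤ 0 →
        ∀ r : ℝ, 0 < r → cknD r z₀ Q ≤ D₀') ∧
      (∀ s : ℝ, s < 0 →
        ∀ᵐ y : EuclideanSpace ℝ (Fin 3), ‖V s y‖ ≤ C' / Real.sqrt (-s)) ∧
      (∀ φ : EuclideanSpace ℝ (Fin 3) → EuclideanSpace ℝ (Fin 3),
        ContDiff ℝ (⊤ : ℕ∞) φ →
        HasCompactSupport φ → ∀ ε : ℝ, 0 < ε →
        ∃ s₀ : ℝ, s₀ < 0 ∧ ∀ᵐ s ∂(volume.restrict (Ioo s₀ 0)), |∫ y, ⟪V s y, φ y⟫| ≤ ε) ∧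
      (∃ e : EuclideanSpace ℝ (Fin 3), ‖e‖ = 1 ∧ ∃ δ : ℝ, 0 < δ ∧ ∃ K : ℝ,
        ∀ᵐ z ∂(volume.restrict (Ioo (-δ) 0 ×ˢ {y : EuclideanSpace ℝ (Fin 3) | 1 < ⟪y, e⟫})),
          ‖V z.1 z.2‖ ≤ K) ∧
      ¬ (∀ᵐ z ∂(volume.restrict (parabolicCylinder 1 (0 : ℝ × EuclideanSpace ℝ (Fin 3)))), V z.1 z.2 = 0) := by
  intro U P G M D₀ C hsw hG hI hD hrate htop hsing hreg hcase
  obtain ⟨y₁, hy₁⟩ := hreg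
  obtain ⟨c₀, hc₀, hcase2⟩ := hcase
  -- ### `C ≥ 0`
  have hC : 0 ≤ C := by
    by_contra hC
    simp only [not_le] at hC
    have h := hrate (-1) (by norm_num)
    rw [neg_neg, Real.sqrt_one, div_one] at h
    have hfalse : ∀ᵐ y : EuclideanSpace ℝ (Fin 3), False := by
      filter_upwards [h] with y hy
      linarith [norm_nonneg (U (-1) y)]
    rw [ae_iff] at hfalse
    simp only [not_false_eq_true, setOf_true] at hfalse
    exact NeZero.ne (volume : Measure (EuclideanSpace ℝ (Fin 3))) (Measure.measure_univ_eq_zero.mp hfalse)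
  -- ### the nearest singular point
  set S : Set (EuclideanSpace ℝ (Fin 3)) :=
    {x : EuclideanSpace ℝ (Fin 3) | IsBackwardSingularPoint U ((0 : ℝ), x)} with hSdef
  have hSc : IsClosed S := isClosed_topSingularSet U
  have hSne : S.Nonempty := ⟨0, show IsBackwardSingularPoint U ((0 : ℝ), (0 : EuclideanSpace ℝ (Fin 3))) from hsing⟩
  set d : ℝ := infDist y₁ S with hddef
  have hd : 0 < d := (hSc.notMem_iff_infDist_pos hSne).1 hy₁
  obtain ⟨xs, hxsS, hxsd⟩ := hSc.exists_infDist_eq_dist hSne y₁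
  have hxs : dist y₁ xs = d := hxsd.symm
  have hfarS : ∀ σ ∈ S, d ≤ dist y₁ σ := fun σ hσ => infDist_le_dist_of_mem hσ
  set e : EuclideanSpace ℝ (Fin 3) := d⁻¹ • (y₁ - xs) with hedef
  have he : ‖e‖ = 1 := by
    rw [hedef, norm_smul, Real.norm_of_nonneg (inv_nonneg.2 hd.le), ← dist_eq_norm, hxs, inv_mul_cancel₀ hd.ne']
  -- ### the translate to `x*` and its zoom limit
  obtain ⟨hsw', hG', hI', hD', hrate', htop'⟩ := apexPackage_translate xs hsw hG hI hD hrate htop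
  have hsing' : IsBackwardSingularPoint (fun s y => U s (y + xs)) (0 : ℝ × EuclideanSpace ℝ (Fin 3)) :=
    (isBackwardSingularPoint_translate_zero_iff xs U).2 hxsS
  obtain ⟨lam, M', D₀', C', V, Q, H, hlam, hlam0, hV, hH, hIV, hDV, hrV, htV, hconv, hne⟩ :=
    exists_apexZoomLimit hsw' hG' hI' hD' hrate' htop' hsing' hC
  -- ### the zooms
  set F : ℕ → ℝ → EuclideanSpace ℝ (Fin 3) → EuclideanSpace ℝ (Fin 3) :=
    fun j => (lam j) • stPull ((lam j) ^ 2) (lam j) (0 : ℝ) (0 : EuclideanSpace ℝ (Fin 3))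
      (fun s y => U s (y + xs)) with hFdef
  have hFapply : ∀ j s y, F j s y = (lam j) • U ((lam j) ^ 2 * s) ((lam j) • y + xs) := by
    intro j s y; simp only [hFdef, Pi.smul_apply, stPull_apply, zero_add]
  have hFm : ∀ j (a : ℝ), 0 < a → AEStronglyMeasurable (uncurry (F j))
      (volume.restrict (parabolicCylinder a (0 : ℝ × EuclideanSpace ℝ (Fin 3)))) := by
    intro j a ha
    have h := ((hsw' (a * lam j) (mul_pos ha (hlam j))).zoomOut (hlam j))
    rw [mul_div_cancel_right₀ a (hlam j).ne'] at h
    have h' := h.1.distributional.1.aestronglyMeasurable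
    rw [coe_parabolicCylinderOpens] at h'
    exact h'
  -- ### wlog `c₀ ≤ 1`
  set c : ℝ := min c₀ 1 with hcdef
  have hcpos : 0 < c := lt_min hc₀ one_pos
  have hcc₀ : c ≤ c₀ := min_le_left _ _
  have hc1 : c ≤ 1 := min_le_right _ _
  -- ### the a.e. bound of ONE zoom on ONE small cylinder `Q_{c/2}(0, y)`, `⟨y,e⟩ > 1`, `|y| < R`, `λ ≤ min 1 (d/R²)`
  have hone : ∀ (R : ℝ), 1 ≤ R → ∀ j, lam j ≤ min 1 (d / R ^ 2) →
      ∀ y : EuclideanSpace ℝ (Fin 3), 1 < ⟪y, e⟫ → ‖y‖ < R →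
      ∀ᵐ z ∂(volume.restrict (parabolicCylinder (c / 2) (((0 : ℝ), y) : ℝ × EuclideanSpace ℝ (Fin 3)))),
        ‖F j z.1 z.2‖ ≤ 2 / c := by
    intro R hR j hj y hy hyR
    set μ : ℝ := lam j with hμdef
    have hμ : 0 < μ := hlam j
    have hμ1 : μ ≤ 1 := hj.trans (min_le_left _ _)
    have hμR : μ ≤ d / R ^ 2 := hj.trans (min_le_right _ _)
    -- the physical point `x = x* + μ y` and its distance to `Σ`
    set x : EuclideanSpace ℝ (Fin 3) := xs + μ • y with hxdef
    have hfar := halfSpace_point_far_from_singular hd hfarS hxs hR hy hyR hμ hμR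
    have hdist : μ / 2 ≤ infDist x S := (le_infDist hSne).2 fun σ hσ => hfar σ hσ
    have hxreg : ¬ IsBackwardSingularPoint U ((0 : ℝ), x) := by
      intro hxS
      have : infDist x S = 0 := infDist_zero_of_mem (by exact hxS)
      linarith
    -- CASE 2 at `x` with radius `c μ / 2`
    have hr : 0 < c * μ / 2 := by positivity
    have hrle : c * μ / 2 ≤ c₀ * min (infDist x S) 1 := by
      have h1 : min (μ / 2) 1 ≤ min (infDist x S) 1 := min_le_min hdist le_rfl
      have h2 : min (μ / 2) 1 = μ / 2 := min_eq_left (by linarith)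
      rw [h2] at h1
      calc c * μ / 2 = c * (μ / 2) := by ring
        _ ≤ c₀ * (μ / 2) := mul_le_mul_of_nonneg_right hcc₀ (by positivity)
        _ ≤ c₀ * min (infDist x S) 1 := mul_le_mul_of_nonneg_left h1 hc₀.le
    have hadm := hcase2 x hxreg (c * μ / 2) hr hrle
    -- transport to the zoom: first translate (`x ↦ x − x*`), then dilate by `μ`
    have hA : MeasurableSet (parabolicCylinder (c * μ / 2) (((0 : ℝ), x) : ℝ × EuclideanSpace ℝ (Fin 3))) :=
      measurableSet_Ioo.prod measurableSet_ball
    have h1 := ae_restrict_comp_translate xs hA hadm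
    rw [preimage_translate_parabolicCylinder_top xs x] at h1
    -- `h1`: a.e. on `Q_{cμ/2}(0, μ y)`, `‖U z.1 (z.2 + x*)‖ ≤ (cμ/2)⁻¹`
    have hxy : x - xs = μ • y := by rw [hxdef]; abel
    rw [hxy] at h1
    have hSm : MeasurableSet (parabolicCylinder (c * μ / 2) (((0 : ℝ), μ • y) : ℝ × EuclideanSpace ℝ (Fin 3))) :=
      measurableSet_Ioo.prod measurableSet_ball
    have hS'm : MeasurableSet (parabolicCylinder (c / 2) (((0 : ℝ), y) : ℝ × EuclideanSpace ℝ (Fin 3))) :=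
      measurableSet_Ioo.prod measurableSet_ball
    rw [ae_restrict_iff' hSm] at h1
    rw [ae_restrict_iff' hS'm]
    filter_upwards [(quasiMeasurePreserving_parabolicDilation hμ.ne').ae h1] with z hz hzS'
    rw [mem_parabolicCylinder] at hzS'
    have hmem : ((μ ^ 2 * z.1, μ • z.2) : ℝ × EuclideanSpace ℝ (Fin 3)) ∈
        parabolicCylinder (c * μ / 2) (((0 : ℝ), μ • y) : ℝ × EuclideanSpace ℝ (Fin 3)) := by
      rw [mem_parabolicCylinder]
      dsimp only at hzS' ⊢
      refine ⟨⟨?_, mul_neg_of_pos_of_neg (pow_pos hμ 2) hzS'.1.2⟩, ?_⟩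
      · have h0 : 0 - (c / 2) ^ 2 < z.1 := hzS'.1.1
        have : μ ^ 2 * (-(c / 2) ^ 2) < μ ^ 2 * z.1 := mul_lt_mul_of_pos_left (by linarith) (pow_pos hμ 2)
        nlinarith
      · rw [dist_eq_norm, ← smul_sub, norm_smul, Real.norm_of_nonneg hμ.le]
        have : dist z.2 y < c / 2 := hzS'.2
        rw [dist_eq_norm] at this
        nlinarith
    have hb := hz hmem
    rw [hFapply, norm_smul, Real.norm_of_nonneg hμ.le]
    have hinv : (c * μ / 2)⁻¹ = 2 / (c * μ) := by rw [inv_div]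
    rw [hinv] at hb
    calc μ * ‖U (μ ^ 2 * z.1) (μ • z.2 + xs)‖ ≤ μ * (2 / (c * μ)) := mul_le_mul_of_nonneg_left hb hμ.le
      _ = 2 / c := by field_simp
  -- ### the a.e. bound on the late half-space slab cut at radius `R`, for all large `j`
  have hR_bound : ∀ (R : ℝ), 1 ≤ R → ∀ᶠ j in atTop,
      ∀ᵐ z ∂(volume.restrict (Ioo (-(c / 2) ^ 2) 0 ×ˢ
        ({y : EuclideanSpace ℝ (Fin 3) | 1 < ⟪y, e⟫} ∩ ball (0 : EuclideanSpace ℝ (Fin 3)) R))),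
        ‖F j z.1 z.2‖ ≤ 2 / c := by
    intro R hR
    have hev : ∀ᶠ j in atTop, lam j ≤ min 1 (d / R ^ 2) :=
      hlam0.eventually (Iic_mem_nhds (lt_min one_pos (by positivity)))
    filter_upwards [hev] with j hj
    -- a countable dense set of centres inside the open set `O_R`
    set O : Set (EuclideanSpace ℝ (Fin 3)) :=
      {y : EuclideanSpace ℝ (Fin 3) | 1 < ⟪y, e⟫} ∩ ball (0 : EuclideanSpace ℝ (Fin 3)) R with hOdef
    have hOo : IsOpen O := (isOpen_lt continuous_const (continuous_id.inner continuous_const)).inter isOpen_ball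
    obtain ⟨D, hDc, hDd⟩ := TopologicalSpace.exists_countable_dense (EuclideanSpace ℝ (Fin 3))
    have hcov : Ioo (-(c / 2) ^ 2) (0 : ℝ) ×ˢ O ⊆
        ⋃ y ∈ D ∩ O, parabolicCylinder (c / 2) (((0 : ℝ), y) : ℝ × EuclideanSpace ℝ (Fin 3)) := by
      rintro ⟨s, y'⟩ ⟨hs, hy'⟩
      have hopen : IsOpen (O ∩ ball y' (c / 2)) := hOo.inter isOpen_ball
      have hne' : (O ∩ ball y' (c / 2)).Nonempty := ⟨y', hy', mem_ball_self (by positivity)⟩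
      obtain ⟨y, hyD, hyO, hyb⟩ := hDd.exists_mem_open hopen hne'
      refine mem_iUnion₂.2 ⟨y, ⟨hyD, hyO⟩, ?_⟩
      rw [mem_parabolicCylinder]
      refine ⟨⟨by simpa using hs.1, by simpa using hs.2⟩, ?_⟩
      rw [mem_ball, dist_comm] at hyb
      simpa using hyb
    refine ae_restrict_of_ae_restrict_of_subset hcov ?_
    rw [ae_restrict_biUnion_iff _ (hDc.mono inter_subset_left)]
    rintro y ⟨-, hyO⟩
    exact hone R hR j hj y hyO.1 (by simpa using hyO.2)
  -- ### pass to the limit `V`, for every `R`, then `R → ∞`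
  have hVR : ∀ (n : ℕ), ∀ᵐ z ∂(volume.restrict (Ioo (-(c / 2) ^ 2) 0 ×ˢ
      ({y : EuclideanSpace ℝ (Fin 3) | 1 < ⟪y, e⟫} ∩ ball (0 : EuclideanSpace ℝ (Fin 3)) ((n : ℝ) + 1)))),
        ‖V z.1 z.2‖ ≤ 2 / c := by
    intro n
    set R : ℝ := (n : ℝ) + 1 with hRdef
    have hR : 1 ≤ R := by rw [hRdef]; linarith [n.cast_nonneg (α := ℝ)]
    set SR : Set (ℝ × EuclideanSpace ℝ (Fin 3)) := Ioo (-(c / 2) ^ 2) 0 ×ˢ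
      ({y : EuclideanSpace ℝ (Fin 3) | 1 < ⟪y, e⟫} ∩ ball (0 : EuclideanSpace ℝ (Fin 3)) R) with hSR
    -- `SR ⊆ Q_{R+1}(0)`
    have ha : 0 < R + 1 := by linarith
    have hsub : SR ⊆ parabolicCylinder (R + 1) (0 : ℝ × EuclideanSpace ℝ (Fin 3)) := by
      rintro ⟨s, y⟩ ⟨hs, -, hy⟩
      rw [mem_parabolicCylinder]
      have hc2 : (c / 2) ^ 2 ≤ 1 := by nlinarith
      refine ⟨⟨?_, by simpa using hs.2⟩, ?_⟩
      · have : (R + 1) ^ 2 ≥ 1 := by nlinarith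
        simp only [Prod.fst_zero, zero_sub]
        linarith [hs.1]
      · have : dist y 0 < R := by simpa using hy
        simp only [Prod.snd_zero]
        linarith
    have hle : volume.restrict SR ≤ volume.restrict (parabolicCylinder (R + 1) (0 : ℝ × EuclideanSpace ℝ (Fin 3))) :=
      Measure.restrict_mono hsub le_rfl
    refine ae_le_of_tendsto_eLpNorm_three (μ := volume.restrict SR) (F := fun j => uncurry (F j)) (V := uncurry V)
      (b := fun _ => 2 / c) (fun j => (hFm j _ ha).mono_measure hle) ((hconv _ ha).1.aestronglyMeasurable.mono_measure hle)
      ?_ (hR_bound R hR)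
    refine tendsto_of_tendsto_of_tendsto_of_le_of_le tendsto_const_nhds (hconv _ ha).2 (fun j => bot_le) fun j => ?_
    exact eLpNorm_mono_measure _ hle
  have hhalf : ∀ᵐ z ∂(volume.restrict (Ioo (-(c / 2) ^ 2) 0 ×ˢ {y : EuclideanSpace ℝ (Fin 3) | 1 < ⟪y, e⟫})),
      ‖V z.1 z.2‖ ≤ 2 / c := by
    have hcov : Ioo (-(c / 2) ^ 2) (0 : ℝ) ×ˢ {y : EuclideanSpace ℝ (Fin 3) | 1 < ⟪y, e⟫} ⊆
        ⋃ n : ℕ, Ioo (-(c / 2) ^ 2) 0 ×ˢ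
          ({y : EuclideanSpace ℝ (Fin 3) | 1 < ⟪y, e⟫} ∩ ball (0 : EuclideanSpace ℝ (Fin 3)) ((n : ℝ) + 1)) := by
      rintro ⟨s, y⟩ ⟨hs, hy⟩
      obtain ⟨n, hn⟩ := exists_nat_gt ‖y‖
      refine mem_iUnion.2 ⟨n, hs, hy, ?_⟩
      rw [mem_ball, dist_zero_right]
      linarith
    refine ae_restrict_of_ae_restrict_of_subset hcov ?_
    rw [ae_restrict_iUnion_iff]
    exact hVR
  exact ⟨M', D₀', C', V, Q, H, hV, hH, hIV, hDV, hrV, htV,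
    ⟨e, he, (c / 2) ^ 2, by positivity, 2 / c, hhalf⟩, hne⟩

end Summit.NavierStokesRegularity.NavierStokesRegularity.Theorems.TypeITraceScarL3

end
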